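import Summits.BirchSwinnertonDyer.BirchSwinnertonDyer.Theorems.KolyvaginDepthDoorDepthTableSteinWuthrichRankThree18745a1
import Summits.BirchSwinnertonDyer.BirchSwinnertonDyer.Theorems.KolyvaginDepthDoorKNSupplyLevelOneStructure
import Summits.BirchSwinnertonDyer.BirchSwinnertonDyer.Theorems.KolyvaginDepthDoorKNSupplyResidualStructureOfPrint
import Summits.BirchSwinnertonDyer.BirchSwinnertonDyer.Theorems.KolyvaginDepthDoorDepthTableRowKitPrint
import Literature.NumberTheory.EllipticCurves.LeadingTermPPartRankLeOne
import Literature.NumberTheory.EllipticCurves.SelmerTorsionTwistRestriction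
import Literature.NumberTheory.EllipticCurves.IrreducibleModPQuadraticTwistProofs
import Literature.NumberTheory.EllipticCurves.ComplexMultiplication
import HarnessLib

/-!
# Route `KolyvaginDepthDoor`, crux `KolyvaginDepthSupplyKN` (stmt-BirchSwinnertonDyer-22820) —
# DEPTH TABLE v14: the RANK-ZERO DATUM of the odd-rank row `18745a1` (at `p = 7`) READ AS ONE `L`-VALUE VALUATION
# — twist `E^{(−11)}` (Skinner 2016 Thm. C and Gross–Zagier–Kolyvagin BY NAME)

Helper file of the lead prover of line `levelone` (kdd-p1 g18; `--supports stmt-BirchSwinnertonDyer-22820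
--as helper`); it closes nothing and BSD is NOT proved by it.

The v14 odd-rank rows (`KolyvaginDepthDoorDepthTableSteinWuthrichRankThree{,<label>}`) leave, per curve, ONE
datum: a bound on the `p`-Selmer group of the Heegner twist, of EVEN analytic rank — for `18745a1` (row at `p = 7`,
`…RankThree18745a1`) and `K = ℚ(√−11)` the twist `T = E^{(−11)}` with `L(T, 1) ≠ 0` numerically (`≈ 6.62`; context only).
This file (the `5077a1` pattern of `…RankThree5077a1TwistLValue`) reads that datum in `L`-VALUE currency. `T` has the
global minimal model `T₀ = [0, −11, 1, −17666, −846849]` (`Δ = −5²·11⁶·23²·163`, `N_T = 11²·18745 = 2 268 145`, additive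
`I₀*` at `11`, multiplicative at `5, 23, 163`), `ℚ`-isomorphic to the tree's `E.quadraticTwist (−11)` by the translation
`t = −1/2` (`twist_smul_eq`). Kernel certificates (all `decide`): `isElliptic_twist11`,
`isGloballyMinimal_twist11` (no prime has `q⁷ ∣ Δ`; Silverman's `Δ`-criterion with `k = 6`), `intModel_twist11`,
`card_7_twist11` (`#T̃(𝔽₇) = 4`, `a_7(T) = 4`: good ORDINARY), `hasMultiplicativeReductionAtPrime_163_twist11`
with `v_163(Δ_T) = 1`, `kodairaNeron_7_twist11` (`7 ∤ ord_v Δ_T` at multiplicative `v`: exponents `2, 2, 1`; hence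
`7 ∤ Tam(T)` — the additive fibre has `c_11 ≤ 4`), `hasIrreducibleModPGaloisRep_7_twist11` (twist of the onto `ρ̄_{E,7}`).

* `natCard_selmerGroup_twist11_eq_one_of_LValue` — **Skinner 2016 Thm. C + GZK ⟹ the datum.** IF `L(T, 1) ≠ 0`
  and the algebraic part `L(T,1)/Ω_T ∈ ℚ` has `ord_7 ≤ 0`, THEN `#Sel_7(T/ℚ) = 1`: GZK (`rank T = 0`, `Ш(T)`
  finite), Skinner's `ord_7(L(T,1)/Ω_T) = ord_7 #Ш(T) + ord_7 Tam(T)` (good ordinary `7`, `T[7]` irreducible,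
  the ramified multiplicative prime `163`), `7 ∤ Tam(T)`, so `7 ∤ #Ш(T)`, `Ш(T)[7] = 0`, and the exact descent
  count with `T(ℚ)[7] = 0`.
* `natCard_selmerGroup_quadraticTwist_neg11_eq_one_of_LValue` — the same transported to `E.quadraticTwist (−11)`
  (`natCard_selmerGroup_eq_of_variableChange`): exactly the hypothesis `hT` of `C18745a1.cruxBody_of_twistSelmer`
  (`…RankThree18745a1`) and, `rank = 3` being kernel there, the right-hand side `≤ 49` of the depth-TWO row
  `exactRowDepthTwo_7_neg11_iff_twistSelmer`: the instrument then PREDICTS a non-zero depth-2 class `c_1(ℓ₁ℓ₂) ≢ 0 (mod 7)`.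

So, modulo FOUR named print facts (Stein–Wuthrich 2013 Thm. 1.1, W. Zhang 2014 L8.4 (1) / Thm. 9.1, Skinner 2016
Thm. C, Gross–Zagier–Kolyvagin), the crux `KolyvaginDepthSupplyKN` holds AT `18745a1` as soon as ONE exact
rational number — the algebraic part of `L(E^{(−11)}, 1)`, a modular-symbol computation — has `ord_7 ≤ 0` [and
`L(E^{(−11)},1) ≠ 0`] (composition: `C18745a1.cruxBody_of_twistSelmer … (by rw [this]; norm_num)`). Per curve; nothing class-wide; BSD is NOT proved
by any of this.

References: [Skinner2016PacificMC] Thm. C (p. 173); [Darmon2004] Thm. 3.22 (GZK); [SilvermanAEC2009] VII.1 Rem. 1.1,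
VIII.8, X.4.2, X.5 Cor. 5.4; [CremonaAlgorithms1997] Table 1 (18745a1).
-/

set_option linter.dupNamespace false

noncomputable section

open scoped Classical NumberField

namespace Summit.BirchSwinnertonDyer.BirchSwinnertonDyer.Theorems.KolyvaginDepthDoor

open Literature.NumberTheory.EllipticCurves Literature.NumberTheory.EllipticCurves.ModularForms
  WeierstrassCurve NumberField IsDedekindDomain
open Summit.BirchSwinnertonDyer.BirchSwinnertonDyer.Theorems
open Summit.BirchSwinnertonDyer.BirchSwinnertonDyer.Rank2Observatory
open Summit.BirchSwinnertonDyer.BirchSwinnertonDyer.Rank1Residual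
open Summit.BirchSwinnertonDyer.Rank1Residual.Additive

namespace C18745a1

/-! ## The minimal model `T₀ = [0,−11,1,−17666,−846849]` of the twist `18745a1^{(−11)}` -/

/-- `T₀ = [0,−11,1,−17666,−846849]` is an elliptic curve over `ℚ` (`Δ = −5²·11⁶·23²·163 ≠ 0`, kernel-checked). [folklore] -/
theorem isElliptic_twist11 : ((⟨0, -11, 1, -17666, -846849⟩ : WeierstrassCurve ℤ).map (Int.castRingHom ℚ)).IsElliptic := by
  rw [WeierstrassCurve.isElliptic_iff, WeierstrassCurve.map_Δ, isUnit_iff_ne_zero, eq_intCast, Int.cast_ne_zero]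
  decide +kernel

/-- **`T₀ = [0,−11,1,−17666,−846849]` is a GLOBAL MINIMAL model** (unconditional): `|Δ(T₀)| = 5²·11⁶·23²·163` is
seventh-power-free (a prime `q` with `q⁷ ∣ Δ` has `q < 63`, and none of those divides to the seventh power),
so Silverman's `Δ`-criterion `isGloballyMinimal_baseChange_int_of_finrank_mul_lt_twelve` applies with `k = 6`.
[cite: SilvermanAEC2009, VII.1 Remark 1.1 and VIII.8] -/
theorem isGloballyMinimal_twist11 :
    ((⟨0, -11, 1, -17666, -846849⟩ : WeierstrassCurve ℤ).map (Int.castRingHom ℚ)).IsGloballyMinimal := by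
  have hbc : (⟨0, -11, 1, -17666, -846849⟩ : WeierstrassCurve ℤ).map (Int.castRingHom ℚ) =
      (⟨0, -11, 1, -17666, -846849⟩ : WeierstrassCurve ℤ).baseChange ℚ := by
    ext <;> simp [WeierstrassCurve.baseChange, WeierstrassCurve.map]
  rw [hbc]
  refine isGloballyMinimal_baseChange_int_of_finrank_mul_lt_twelve _ ℚ 6 (fun q hq hdvd ↦ ?_)
    (by rw [Module.finrank_self]; norm_num)
  have hΔ : (⟨0, -11, 1, -17666, -846849⟩ : WeierstrassCurve ℤ).Δ = -(3818909758675 : ℕ) := by decide +kernel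
  rw [hΔ, Int.dvd_neg] at hdvd
  have h1 : q ^ 7 ∣ 3818909758675 := by exact_mod_cast hdvd
  have hle : q ^ 7 ≤ 3818909758675 := Nat.le_of_dvd (by norm_num) h1
  have hq18 : q < 63 := by
    by_contra h
    have h18 : 63 ^ 7 ≤ q ^ 7 := Nat.pow_le_pow_left (by omega) 7
    norm_num at h18
    omega
  interval_cases q <;> first | (norm_num at hq; done) | exact absurd h1 (by decide)

/-- The integral model `[0,−11,1,−17666,−846849]` is its own `integralModelInt` (globally minimal). [folklore] -/
theorem intModel_twist11 :
    haveI := isGloballyMinimal_twist11;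
    integralModelInt ((⟨0, -11, 1, -17666, -846849⟩ : WeierstrassCurve ℤ).map (Int.castRingHom ℚ)) =
      ⟨0, -11, 1, -17666, -846849⟩ := by
  haveI := isGloballyMinimal_twist11
  exact IntModel.integralModelInt_eq_of_map_eq _ rfl

/-- **`T₀` is `ℚ`-isomorphic to the tree's twist `E.quadraticTwist (−11)` of `E = 18745a1`** by the translation
`y ↦ y − 1/2` (`u = 1`, `r = s = 0`, `t = −1/2`): `b₂(T₀) = −11·b₂(E)`, `b₄(T₀) = 121·b₄(E)`, `b₆(T₀) = −1331·b₆(E)`,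
and `E.quadraticTwist d = ⟨0, d b₂/4, 0, d² b₄/2, d³ b₆/4⟩`. [cite: SilvermanAEC2009, X.5 Cor. 5.4] -/
theorem twist_smul_eq :
    (⟨1, 0, 0, -(1 : ℚ) / 2⟩ : WeierstrassCurve.VariableChange ℚ) •
        ((⟨0, -11, 1, -17666, -846849⟩ : WeierstrassCurve ℤ).map (Int.castRingHom ℚ)) =
      (c18745a1.e.baseChange ℚ).quadraticTwist (-11 : ℚ) := by
  haveI := isElliptic_of_mem_atlasR3A00 mem_atlas
  haveI := isGloballyMinimal_of_mem_atlasR3A00 mem_atlas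
  have h : c18745a1.e.baseChange ℚ = (⟨0, 1, 1, -146, 636⟩ : WeierstrassCurve ℤ).baseChange ℚ :=
    eq_baseChange_of_intModel intModel
  rw [h]
  ext <;> simp only [WeierstrassCurve.map_a₁, WeierstrassCurve.map_a₂, WeierstrassCurve.map_a₃,
      WeierstrassCurve.map_a₄, WeierstrassCurve.map_a₆, WeierstrassCurve.variableChange_a₁,
      WeierstrassCurve.variableChange_a₂, WeierstrassCurve.variableChange_a₃,
      WeierstrassCurve.variableChange_a₄, WeierstrassCurve.variableChange_a₆, WeierstrassCurve.quadraticTwist,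
      WeierstrassCurve.b₂, WeierstrassCurve.b₄, WeierstrassCurve.b₆, WeierstrassCurve.baseChange, Units.val_one,
      inv_one] <;> norm_num

/-- `#T̃₀(𝔽₇) = 4`, i.e. `a_7(T) = 4 = χ_{−11}(7)·a_7(E)` (kernel-decided). [cite: SilvermanAEC2009, V.2] -/
theorem card_7_twist11 :
    Nat.card (((⟨0, -11, 1, -17666, -846849⟩ : WeierstrassCurve ℤ).map (Int.castRingHom (ZMod 7))).toAffine.Point) =
      4 := by
  rw [PointCountNat.natCard_point_map_eq (hℓ := ⟨by norm_num⟩) (by norm_num) 0 (-11) 1 (-17666) (-846849)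
    (by decide +kernel)]
  decide +kernel

/-- **`7` is a prime of good ORDINARY reduction for `T`** (`7 ∤ Δ_T`, `a_7(T) = 4`). [cite: SilvermanAEC2009, VII.5 Prop. 5.1 (a)] -/
theorem goodOrdinary_7_twist11 :
    haveI := isGloballyMinimal_twist11;
    haveI := Fact.mk (by norm_num : Nat.Prime 7);
    ((⟨0, -11, 1, -17666, -846849⟩ : WeierstrassCurve ℤ).map (Int.castRingHom ℚ)).HasGoodReductionAtPrime 7 ∧
      ¬ ((7 : ℕ) : ℤ) ∣ ((⟨0, -11, 1, -17666, -846849⟩ : WeierstrassCurve ℤ).map (Int.castRingHom ℚ)).frobeniusTrace 7 := by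
  haveI := isGloballyMinimal_twist11
  haveI := Fact.mk (by norm_num : Nat.Prime 7)
  exact goodOrdinary_of_intModel_certificate intModel_twist11 7 (by decide +kernel) (n := 4) card_7_twist11
    (by decide +kernel)

/-- **`T` has multiplicative reduction at `163` with `v_163(Δ_T) = 1`** (`163 ∥ Δ_T`, `163 ∤ c₄(T) = 121·7024`):
Skinner's ramified auxiliary prime. [cite: SilvermanAEC2009, VII.5 Prop. 5.1 (b)] -/
theorem hasMultiplicativeReductionAtPrime_163_twist11 :
    haveI := isElliptic_twist11; haveI := isGloballyMinimal_twist11;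
    haveI := Fact.mk (by norm_num : Nat.Prime 163);
    ((⟨0, -11, 1, -17666, -846849⟩ : WeierstrassCurve ℤ).map (Int.castRingHom ℚ)).HasMultiplicativeReductionAtPrime 163 ∧
      padicValInt 163 ((⟨0, -11, 1, -17666, -846849⟩ : WeierstrassCurve ℤ).map (Int.castRingHom ℚ)).minimalDiscriminantInt = 1 := by
  haveI := isElliptic_twist11
  haveI := isGloballyMinimal_twist11
  haveI := Fact.mk (by norm_num : Nat.Prime 163)
  refine ⟨IntModel.hasMultiplicativeReductionAtPrime_of_intModel intModel_twist11 163 (by decide +kernel)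
      (by decide +kernel), ?_⟩
  rw [IntModel.minimalDiscriminantInt_eq intModel_twist11]
  exact IntModel.padicValInt_eq_of_dvd_of_not_dvd 163 (e := 1) (by decide +kernel) (by decide +kernel)

/-- **Kodaira–Néron for `T` at `7`**: `7 ∤ ord_v(Δ_T)` at every multiplicative place (`|Δ_T| = 5²·11⁶·23²·163`:
exponents `2, 2, 1` at the multiplicative primes; the table also certifies `7 ∤ 6` at the additive prime `11`). Hence
`7 ∤ Tam(T)` (`not_dvd_tamagawaProduct_of_kodairaNeron`: `c_v ≤ 4 < 7` at additive `v`).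
[cite: SilvermanAEC2009, VII.5.1, VIII.8, C.15 Table 15.1] -/
theorem kodairaNeron_7_twist11 :
    haveI := isElliptic_twist11; haveI := isGloballyMinimal_twist11;
    ∀ v : HeightOneSpectrum (𝓞 ℚ),
      ((⟨0, -11, 1, -17666, -846849⟩ : WeierstrassCurve ℤ).map (Int.castRingHom ℚ)).HasMultiplicativeReductionAt v →
      ¬ 7 ∣ ((⟨0, -11, 1, -17666, -846849⟩ : WeierstrassCurve ℤ).map (Int.castRingHom ℚ)).ordMinimalDiscriminant v := by
  haveI := isElliptic_twist11
  haveI := isGloballyMinimal_twist11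
  exact not_dvd_ordMinimalDiscriminant_of_intModel_table intModel_twist11 (p := 7) (Δ₀ := -3818909758675)
    (by decide +kernel) (B := 63) (by decide +kernel) (by decide +kernel)

/-- **`T[7]` is irreducible** — `ρ̄_{E,7}` is onto for `E = 18745a1` (`hasSurjectiveModNGaloisRep_pow_7`), irreducibility
is twist-invariant (`hasIrreducibleModPGaloisRep_iff_of_smul_eq_quadraticTwist`, Silverman X.5 Cor. 5.4) and `T₀`
is `ℚ`-isomorphic to `E^{(−11)}` (`twist_smul_eq`). [cite: SilvermanAEC2009, X.5 Cor. 5.4] [cite: Serre1972, §5.4 Prop. 21] -/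
theorem hasIrreducibleModPGaloisRep_7_twist11 :
    ((⟨0, -11, 1, -17666, -846849⟩ : WeierstrassCurve ℤ).map (Int.castRingHom ℚ)).HasIrreducibleModPGaloisRep 7 := by
  haveI := isElliptic_of_mem_atlasR3A00 mem_atlas
  haveI := isGloballyMinimal_of_mem_atlasR3A00 mem_atlas
  haveI := Fact.mk (by norm_num : Nat.Prime 7)
  have hsur : (c18745a1.e.baseChange ℚ).HasSurjectiveModNGaloisRep (7 : ℕ) := by
    simpa only [pow_one] using hasSurjectiveModNGaloisRep_pow_7 1
  have hirr : (c18745a1.e.baseChange ℚ).HasIrreducibleModPGaloisRep 7 :=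
    hasIrreducibleModPGaloisRep_of_hasSurjectiveModNGaloisRep _ 7 hsur
  exact ((c18745a1.e.baseChange ℚ).hasIrreducibleModPGaloisRep_iff_of_smul_eq_quadraticTwist _
    (by norm_num : (-11 : ℚ) ≠ 0) twist_smul_eq 7).mpr hirr

/-! ## The rank-zero datum as an `L`-value valuation (Skinner 2016 Thm. C, GZK, by name) -/

/-- An abelian group whose `Nat.card` is prime to `p` (so finite) has no `p`-torsion: `Ш ⊓ H¹[p] = ⊥` when
`p ∤ #Ш` (Lagrange: the order of a `p`-torsion element divides `gcd(p, #Ш) = 1`). [folklore] -/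
private theorem sha_inf_torsionBy_eq_bot_of_not_dvd_card (V : WeierstrassCurve ℚ) [V.IsElliptic] (p : ℕ)
    (hp : p.Prime) (hnd : ¬ p ∣ Nat.card V.sha) :
    (V.sha ⊓ AddSubgroup.torsionBy V.galH1 (p : ℤ) : AddSubgroup V.galH1) = ⊥ := by
  rw [eq_bot_iff]
  intro c hc
  obtain ⟨hsha, htor⟩ := AddSubgroup.mem_inf.mp hc
  have hn : p • c = 0 := AddSubgroup.torsionBy.nsmul_iff.mp htor
  set y : V.sha := ⟨c, hsha⟩ with hy
  have hy0 : p • y = 0 := Subtype.ext (by simpa [hy] using hn)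
  have h1 : addOrderOf y ∣ p := addOrderOf_dvd_of_nsmul_eq_zero hy0
  have h2 : addOrderOf y ∣ Nat.card V.sha := addOrderOf_dvd_natCard y
  have hcop : Nat.Coprime p (Nat.card V.sha) := (Nat.Prime.coprime_iff_not_dvd hp).mpr hnd
  have hone : addOrderOf y = 1 := by
    have h := Nat.dvd_gcd h1 h2
    rw [Nat.Coprime.gcd_eq_one hcop] at h
    exact Nat.dvd_one.mp h
  have hy' : y = 0 := AddMonoid.addOrderOf_eq_one_iff.mp hone
  rw [AddSubgroup.mem_bot]
  simpa [hy] using congrArg Subtype.val hy'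

/-- **THE RANK-ZERO DATUM OF THE `18745a1` ROW AS ONE `L`-VALUE VALUATION (Skinner 2016 Thm. C + GZK by name).**
For the twist `T = 18745a1^{(−11)}` (minimal model `T₀ = [0,−11,1,−17666,−846849]`): IF `L(T, 1) ≠ 0` and the algebraic
part `L(T,1)/Ω_T ∈ ℚ` satisfies `ord_7(L(T,1)/Ω_T) ≤ 0`, THEN `#Sel_7(T/ℚ) = 1`. Chain: `r_an(T) = 0`; GZK (`hGZK`):
`rank T = 0`, `Ш(T)` finite; Skinner 2016 Thm. C (`hSk`; good ordinary `7`, `T[7]` irreducible, the multiplicative prime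
`163` with `7 ∤ v_163(Δ_T) = 1`): `ord_7(L(T,1)/Ω_T) = ord_7 #Ш(T) + ord_7 Tam(T)`; Kodaira–Néron: `7 ∤ Tam(T)`; so
`7 ∤ #Ш(T)`, `Ш(T)[7] = 0`, and `#Sel_7(T) = 7^{rank T} = 1` (`T(ℚ)[7] = 0` by irreducibility). CONDITIONAL on the two
named facts; per curve; BSD is not proved by it. [cite: Skinner2016PacificMC, Thm. C (p. 173)] [cite: Darmon2004, Thm. 3.22]
[cite: SilvermanAEC2009, Thm. X.4.2] -/
theorem natCard_selmerGroup_twist11_eq_one_of_LValue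
    (hSk : Skinner2016_padicValRat_bsd_rank_zero) (hGZK : rank_eq_analyticRank_of_analyticRank_le_one)
    (hL : haveI := isElliptic_twist11;
      ((⟨0, -11, 1, -17666, -846849⟩ : WeierstrassCurve ℤ).map (Int.castRingHom ℚ)).entireLFunction 1 ≠ 0)
    (hval : haveI := isElliptic_twist11; haveI := isGloballyMinimal_twist11;
      ∀ q : ℚ, ((⟨0, -11, 1, -17666, -846849⟩ : WeierstrassCurve ℤ).map (Int.castRingHom ℚ)).entireLFunction 1 /
          ((((⟨0, -11, 1, -17666, -846849⟩ : WeierstrassCurve ℤ).map (Int.castRingHom ℚ)).realPeriodRat : ℝ) : ℂ) = (q : ℂ) →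
        padicValRat 7 q ≤ 0) :
    haveI := isElliptic_twist11;
    Nat.card (((⟨0, -11, 1, -17666, -846849⟩ : WeierstrassCurve ℤ).map (Int.castRingHom ℚ)).selmerGroup (7 : ℕ)) = 1 := by
  haveI := isElliptic_twist11
  haveI := isGloballyMinimal_twist11
  haveI i7 := Fact.mk (by norm_num : Nat.Prime 7)
  set T := (⟨0, -11, 1, -17666, -846849⟩ : WeierstrassCurve ℤ).map (Int.castRingHom ℚ) with hT
  -- analytic rank zero, hence (GZK) rank zero and finite Ш
  have h0 : T.analyticRank = 0 := analyticRank_eq_zero_of_entireLFunction_one_ne_zero T hL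
  obtain ⟨hrank, hfin⟩ := hGZK T (by rw [h0]; norm_num)
  rw [h0] at hrank
  -- Skinner 2016 Thm. C at (T, 7)
  haveI i163 := Fact.mk (by norm_num : Nat.Prime 163)
  have hram : ∃ q : ℕ, ∃ _ : Fact q.Prime, q ≠ 7 ∧ T.HasMultiplicativeReductionAtPrime q ∧
      ¬ 7 ∣ padicValInt q T.minimalDiscriminantInt :=
    ⟨163, i163, by norm_num, hasMultiplicativeReductionAtPrime_163_twist11.1,
      by rw [hasMultiplicativeReductionAtPrime_163_twist11.2]; norm_num⟩
  obtain ⟨q, hq, hv⟩ := hSk T 7 (by norm_num) (Or.inl goodOrdinary_7_twist11) hasIrreducibleModPGaloisRep_7_twist11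
    hram hL hfin
  have hv0 : padicValRat 7 q ≤ 0 := hval q hq
  have htam : ¬ 7 ∣ T.tamagawaProduct := not_dvd_tamagawaProduct_of_kodairaNeron T 7 (by norm_num) kodairaNeron_7_twist11
  have htam0 : padicValNat 7 T.tamagawaProduct = 0 := padicValNat.eq_zero_of_not_dvd htam
  have hle : ((padicValNat 7 T.shaOrder : ℕ) : ℤ) + ((padicValNat 7 T.tamagawaProduct : ℕ) : ℤ) ≤ 0 := by
    rw [← hv]; exact hv0
  have hsha0 : padicValNat 7 T.shaOrder = 0 := by omega
  -- `7 ∤ #Ш(T)`, so `Ш(T)[7] = 0`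
  haveI : Finite T.sha := hfin
  have hpos : T.shaOrder ≠ 0 := by
    rw [WeierstrassCurve.shaOrder]; exact Nat.card_pos.ne'
  have hnd : ¬ 7 ∣ T.shaOrder := by
    rcases padicValNat.eq_zero_iff.mp hsha0 with h | h | h
    · norm_num at h
    · exact absurd h hpos
    · exact h
  have hshaT : (T.sha ⊓ AddSubgroup.torsionBy T.galH1 ((7 : ℕ) : ℤ) : AddSubgroup T.galH1) = ⊥ :=
    sha_inf_torsionBy_eq_bot_of_not_dvd_card T 7 (by norm_num) (by rwa [WeierstrassCurve.shaOrder] at hnd)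
  rw [natCard_selmerGroup_eq_pow_rank_of_sha_inf_torsionBy_eq_bot T 7 hasIrreducibleModPGaloisRep_7_twist11 hshaT,
    hrank, pow_zero]

/-- **The same datum on the tree's twist `E.quadraticTwist (−11)`** (`E = 18745a1`): under the two `L`-value hypotheses,
`#Sel_7(E^{(−11)}/ℚ) = 1` — transported along `twist_smul_eq` (`natCard_selmerGroup_eq_of_variableChange`). This is (more than)
the hypothesis `hT : #Sel_7(E^{(d_K)}) ≤ 7³` of `C18745a1.cruxBody_of_twistSelmer`, and the right-hand side `≤ 49` of the
depth-two row, for every `K` with `d_K = −11`. CONDITIONAL on Skinner 2016 Thm. C and GZK by name; per curve; BSD is not proved by it.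
[cite: Skinner2016PacificMC, Thm. C (p. 173)] [cite: Darmon2004, Thm. 3.22] [cite: SilvermanAEC2009, X.§4] -/
theorem natCard_selmerGroup_quadraticTwist_neg11_eq_one_of_LValue
    (hSk : Skinner2016_padicValRat_bsd_rank_zero) (hGZK : rank_eq_analyticRank_of_analyticRank_le_one)
    (hL : haveI := isElliptic_twist11;
      ((⟨0, -11, 1, -17666, -846849⟩ : WeierstrassCurve ℤ).map (Int.castRingHom ℚ)).entireLFunction 1 ≠ 0)
    (hval : haveI := isElliptic_twist11; haveI := isGloballyMinimal_twist11;
      ∀ q : ℚ, ((⟨0, -11, 1, -17666, -846849⟩ : WeierstrassCurve ℤ).map (Int.castRingHom ℚ)).entireLFunction 1 /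
          ((((⟨0, -11, 1, -17666, -846849⟩ : WeierstrassCurve ℤ).map (Int.castRingHom ℚ)).realPeriodRat : ℝ) : ℂ) = (q : ℂ) →
        padicValRat 7 q ≤ 0) :
    haveI := isElliptic_of_mem_atlasR3A00 mem_atlas;
    Nat.card (((c18745a1.e.baseChange ℚ).quadraticTwist (-11 : ℚ)).selmerGroup (7 : ℕ)) = 1 := by
  rw [← natCard_selmerGroup_eq_of_variableChange ((7 : ℕ) : ℤ) twist_smul_eq]
  exact natCard_selmerGroup_twist11_eq_one_of_LValue hSk hGZK hL hval

end C18745a1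

end Summit.BirchSwinnertonDyer.BirchSwinnertonDyer.Theorems.KolyvaginDepthDoor

end
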